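import Literature.NumberTheory.Sieve.LinearEquationsInPrimesSharpGYEuler
import HarnessLib

/-!
# Linear equations in primes: the Goldston–Yıldırım engine with exponents `a_i = 1`, II — the
# main term (Green–Tao 2010, App. D) — placeholder, content relocated

The content formerly in this module — the evaluation of the main term of the `a_i = 1`
Goldston–Yıldırım engine (Green–Tao 2010, App. D, (D.14)–(D.17) with the sieve factor of
Lemma D.2 for `a = 1`: `SharpGY.mainFactor`, `SharpGY.exists_mainFactor_integral_bound`,
`SharpGY.integral_phiF_mul_aF`, `SharpGY.logpow_mul_main_eq`, `SharpGY.limitFn`,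
`SharpGY.exists_main_term_bound`, and their lemmas) — now lives, verbatim and under the same
names, in `Literature/NumberTheory/Sieve/LinearEquationsInPrimesSharpGYCorrelation.lean`, which
holds parts II (main term) and III (local factors of `W`-tricked systems, correlation estimate,
Thm. D.3 with `a_i = 1`) of the engine together; part I is
`LinearEquationsInPrimesSharpGYEuler.lean`, and (12.6) with the final assemblies of Thm. 7.2 is
`LinearEquationsInPrimesSharpUniform.lean`.

(Relocation for an infrastructural reason only: the library build never produced a compiled
artifact for this module name, so that no importer of it could be verified; this file keeps a
single elementary lemma and is imported by nothing. It may be removed.)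

## References

* B. Green, T. Tao, *Linear equations in primes*, Ann. of Math. (2) 171 (2010), 1753–1850
  (arXiv:math/0606088), App. D.
-/

namespace Literature.NumberTheory.Sieve.SharpGY

open Finset in
/-- `∏_{i∈s} (1 + u_i) - 1 ≤ (∑_{i∈s} u_i) e^{∑_{i∈s} u_i}` for `u_i ≥ 0` (from `1 + u ≤ e^u` and
`1 - x ≤ e^{-x}`; the form in which `∏_{p>w} β_p = ∏_{p>w} (1 + O(2^t/p²)) = 1 + O(2^t/w)`,
p. 1834, is used). [folklore] -/
theorem prod_one_add_sub_one_le_sum_mul_exp {α : Type*} (s : Finset α) {u : α → ℝ}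
    (hu : ∀ i ∈ s, 0 ≤ u i) :
    ∏ i ∈ s, (1 + u i) - 1 ≤ (∑ i ∈ s, u i) * Real.exp (∑ i ∈ s, u i) := by
  have h1 : ∏ i ∈ s, (1 + u i) ≤ Real.exp (∑ i ∈ s, u i) := by
    rw [Real.exp_sum]
    exact prod_le_prod (fun i hi => by linarith [hu i hi]) fun i _ => by
      linarith [Real.add_one_le_exp (u i)]
  set x := ∑ i ∈ s, u i
  have h := Real.add_one_le_exp (-x)
  have hx' : Real.exp (-x) * Real.exp x = 1 := by rw [← Real.exp_add, neg_add_cancel, Real.exp_zero]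
  nlinarith [Real.exp_pos x, Real.exp_pos (-x)]

end Literature.NumberTheory.Sieve.SharpGY
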